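import Summits.QuantumFields.BalabanUV.T4Continuum.Support.B13Readings

/-!
# B13ReadingsLocal — row O4-r: THE LOCAL READING OF THE POTENTIAL SPECIES `potQ`∕`potR` (verdict sheet (M1-pot)): their two-run entry
# discrepancy dominated by ONE site-reading discrepancy of node NE3's carrier ⟹ their `SpeciesEntryBound` conjuncts from NE3's `LocalRate`

Cell `pub-balaban`, unit `b2b-balaban-t4-ne5-p1` (row NE5 OWNER, gen 33; owner item «g33-c»).  Summits-side NEW WORK under the LEAN PLACEMENT RULE (readings =
identifications + bookkeeping; print cited for KIND only).  HONEST FRAMING: rung (B)+1 of the FINITE-VOLUME T⁴ continuum programme — NOT infinite volume,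
NOT a mass gap, NOT the Clay problem, NOT a proof of NE5 (NOT PRINTED: the series prints ε-UNIFORM bounds, never η-RATES; GAPS G-t4-U3-1), NOT a proof
of NE3.  HONEST DEPENDENCY (cell, verbatim): continuum YM on T⁴ ⇐ BetaPertH ∧ nine spine estimates (0/9 proved); BetaPertH ⇐ (D1) ∧ (D4) ∧ CAP+tail; G-an2-4
gates asym, D1 and NE2/3/4.

WHAT THIS FILE TYPES (no estimate).  The END OF RECORD takes W1 as `WeightedEntrywiseRate` = five `B13Readings.SpeciesEntryBound` conjuncts.  The covariance
conjunct is READ from row NE2's objects (`B13Readings` §3 at `U = 1`; `B13ReadingsDecay` at Bałaban's tier-B background, gen 33).  The POTENTIAL species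
`potQ`∕`potR` — by the owner's answer Q-S8 = (α) LETTERS of `(g k, U)`: [Balaban1988RG2Cluster] Lemma 2 (1.42)–(1.43) p. 11, the quadratic-form kernel
`Q(Y, U, J, B; b, b′)` and the 𝐏^{(k)}-derived operator part of 𝐕″_k, fine-lattice Taylor data of the Wilson action at the background — are NOT row NE2's kind
of object: their two-run discrepancy (run A: spacing `η`, background `transport U`; run B: spacing `η∕L`, background `U`) is a LOCAL rate of NODE NE3's KIND
(backgrounds∕minimisers of the two runs read at unit-scale sites).  This file types exactly that READING and composes it with NE3's `LocalRate` BY NAME: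

§1 `PotQLipschitzReading R Fk rawA rawB W Λ` ∕ `PotRLipschitzReading …` — HYPOTHESIS SHAPES (asserted by nobody): at every step `k` of the window the potential
   entry discrepancy is dominated by `Λ ×` ONE consecutive-level site-reading discrepancy `|R.loc (k+1) V ξ − R.loc k V ξ|` of node NE3's carrier `R` (the SAME
   pattern as the second leg of `OutputRateTowerSocket.operatorRate_of_towerLaw_split`, `hLip`∕`hdom`, and the liaison's `minDist_of_localRate`) `×` the format
   weight of the entry;
§2 **`potQ_entryBound_of_localRate`** ∕ **`potR_entryBound_of_localRate`**: `LocalRate R C θ` (node U1b, OPEN, displayed) ⟹ the `potQ`∕`potR` conjuncts of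
   `SpeciesEntryBound` with `Λ·C·θ^k`; the `NE3Shape` faces `…_of_ne3Shape` (node U1b's full shape carries its own honest rate);
§3 `entryBound_mono` — a per-entry monotonicity in (constant, rate) so that conjuncts read at different rates (`√(max θ L⁻¹)` for the covariance species,
   `θ` here) assemble into ONE `SpeciesEntryBound … (c·Θ^k)` at the slowest rate `Θ` (the END of record takes any rate `< 1`).

So AT THE END OF RECORD the W1 census of the verdict sheet reads, species by species: (M1-cov) ⇐ NE3 ∧ (3.35)-class ∧ threshold ∧ `hdec` ∧ tower reading
(`B13ReadingsDecay`); (M1-pot) ⇐ NE3 ∧ THIS Lipschitz reading (displayed — its instance on Bałaban's (1.42) data is the substrate's O1 ∕ a [B9]-type regularity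
input, NOT in the tree); (M1-Δ) `deltaKer`∕`gammaConstituent` — not typed here.  Model level; statements OURS; NE5 ∕ NE3 NOT proved; 0∕12 leaves on Bałaban's
concrete objects unchanged; spine 0∕9.  `FlowStep.BetaPertH`, (B), (B^μ) do not occur.  ABSOLUTE RULE kept; no `def … : Prop` fact beyond the two tagged
hypothesis shapes; 0 sorry.
-/

noncomputable section

namespace Summit.QuantumFields.BalabanUV.T4Continuum.B13ReadingsLocal

open Summit.QuantumFields.BalabanUV.T4Continuum.B13OpDatum
open Summit.QuantumFields.BalabanUV.T4Continuum.B13Readings (SpeciesEntryBound)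
open Literature.MathematicalPhysics.QuantumFieldTheory.Balaban1983to89.T4EtaRateMin (Readings LocalRate NE3Shape)

variable {T κ ι Ω 𝒴 Bg ιR XR : Type*}

/-! ## §1 The Lipschitz readings of the potential species on node NE3's carrier (hypothesis shapes) -/

/-- HYPOTHESIS SHAPE **`PotQLipschitzReading`** (row O4-r; asserted by nobody): on the window, run A's and run B's quadratic-form kernels `Q(Y; b, b′)` at field
argument `x` differ, entry by entry and against the step-`k` format weight, by at most `Λ ×` ONE consecutive-level site-reading discrepancy of node NE3's carrier
`R` at an admissible datum — the potential species being letters of the background (Q-S8 (α)), whose two runs' backgrounds are what `R` reads. [folklore] -/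
@[folklore]
def PotQLipschitzReading (R : Readings ιR XR) (Fk : ℕ → Format (Species T κ ι Ω 𝒴))
    (rawA rawB : (ℕ → ℝ) → Bg → ℕ → RawSpecies T κ ι Ω 𝒴) (W : Set (ℕ → ℝ)) (Λ : ℝ) : Prop :=
  ∀ k, ∀ g ∈ W, ∀ (U : Bg) (x : Ω) (Y : 𝒴) (b b' : κ), ∃ V ∈ R.dom, ∃ ξ : XR,
    ‖(rawA g U k).potQ x Y b b' - (rawB g U k).potQ x Y b b'‖ ≤ Λ * |R.loc (k + 1) V ξ - R.loc k V ξ| * (Fk k).wt (.potQ x Y b b')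

/-- HYPOTHESIS SHAPE **`PotRLipschitzReading`**: the same for the operator parts of `𝐕″_k(Y, ·)`. [folklore] -/
@[folklore]
def PotRLipschitzReading (R : Readings ιR XR) (Fk : ℕ → Format (Species T κ ι Ω 𝒴))
    (rawA rawB : (ℕ → ℝ) → Bg → ℕ → RawSpecies T κ ι Ω 𝒴) (W : Set (ℕ → ℝ)) (Λ : ℝ) : Prop :=
  ∀ k, ∀ g ∈ W, ∀ (U : Bg) (x : Ω) (Y : 𝒴), ∃ V ∈ R.dom, ∃ ξ : XR,
    ‖(rawA g U k).potR x Y - (rawB g U k).potR x Y‖ ≤ Λ * |R.loc (k + 1) V ξ - R.loc k V ξ| * (Fk k).wt (.potR x Y)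

/-! ## §2 The conjuncts from node NE3's `LocalRate` ∕ `NE3Shape` by name -/

/-- [folklore] an elementary step: `a ≤ Λ·t·w`, `t ≤ C·θ^k`, `0 ≤ Λ`, `0 < w` ⟹ `a ≤ Λ·C·θ^k·w`. -/
theorem le_of_reading_of_rate {a Λ t C θ w : ℝ} {k : ℕ} (ha : a ≤ Λ * t * w) (ht : t ≤ C * θ ^ k) (hΛ : 0 ≤ Λ) (hw : 0 < w) :
    a ≤ Λ * C * θ ^ k * w := by
  refine ha.trans ?_
  have h1 : Λ * t ≤ Λ * (C * θ ^ k) := mul_le_mul_of_nonneg_left ht hΛ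
  have h2 : Λ * t * w ≤ Λ * (C * θ ^ k) * w := mul_le_mul_of_nonneg_right h1 hw.le
  simpa [mul_assoc] using h2

/-- [folklore] **(M1-pot), `potQ`: NODE NE3's `LocalRate R C θ` (OPEN, displayed) + the Lipschitz reading ⟹ the `potQ` conjunct of `SpeciesEntryBound` with
`Λ·C·θ^k`** at every step of the window — the liaison's `minDist_of_localRate` pattern, entry by entry. -/
theorem potQ_entryBound_of_localRate {R : Readings ιR XR} {Fk : ℕ → Format (Species T κ ι Ω 𝒴)}
    {rawA rawB : (ℕ → ℝ) → Bg → ℕ → RawSpecies T κ ι Ω 𝒴} {W : Set (ℕ → ℝ)} {Λ C θ : ℝ} (hΛ : 0 ≤ Λ)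
    (hR : LocalRate R C θ) (hread : PotQLipschitzReading R Fk rawA rawB W Λ) (k : ℕ) {g : ℕ → ℝ} (hg : g ∈ W) (U : Bg) (x : Ω)
    (Y : 𝒴) (b b' : κ) :
    ‖(rawA g U k).potQ x Y b b' - (rawB g U k).potQ x Y b b'‖ ≤ Λ * C * θ ^ k * (Fk k).wt (.potQ x Y b b') := by
  obtain ⟨V, hV, ξ, h⟩ := hread k g hg U x Y b b'
  exact le_of_reading_of_rate h (hR k V hV ξ) hΛ ((Fk k).wt_pos _)

/-- [folklore] **(M1-pot), `potR`**: the same for the operator parts of `𝐕″_k`. -/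
theorem potR_entryBound_of_localRate {R : Readings ιR XR} {Fk : ℕ → Format (Species T κ ι Ω 𝒴)}
    {rawA rawB : (ℕ → ℝ) → Bg → ℕ → RawSpecies T κ ι Ω 𝒴} {W : Set (ℕ → ℝ)} {Λ C θ : ℝ} (hΛ : 0 ≤ Λ)
    (hR : LocalRate R C θ) (hread : PotRLipschitzReading R Fk rawA rawB W Λ) (k : ℕ) {g : ℕ → ℝ} (hg : g ∈ W) (U : Bg) (x : Ω)
    (Y : 𝒴) : ‖(rawA g U k).potR x Y - (rawB g U k).potR x Y‖ ≤ Λ * C * θ ^ k * (Fk k).wt (.potR x Y) := by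
  obtain ⟨V, hV, ξ, h⟩ := hread k g hg U x Y
  exact le_of_reading_of_rate h (hR k V hV ξ) hΛ ((Fk k).wt_pos _)

/-- [folklore] **THE `NE3Shape` FACE, `potQ`**: node U1b's full shape (which carries its own honest rate `0 ≤ θ < 1`) + the reading ⟹ the conjunct at rate `θ`. -/
theorem potQ_entryBound_of_ne3Shape {R : Readings ιR XR} {Fk : ℕ → Format (Species T κ ι Ω 𝒴)}
    {rawA rawB : (ℕ → ℝ) → Bg → ℕ → RawSpecies T κ ι Ω 𝒴} {W : Set (ℕ → ℝ)} {Λ C θ : ℝ} (hΛ : 0 ≤ Λ)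
    (hNE3 : NE3Shape R C θ) (hread : PotQLipschitzReading R Fk rawA rawB W Λ) (k : ℕ) {g : ℕ → ℝ} (hg : g ∈ W) (U : Bg) (x : Ω)
    (Y : 𝒴) (b b' : κ) :
    ‖(rawA g U k).potQ x Y b b' - (rawB g U k).potQ x Y b b'‖ ≤ Λ * C * θ ^ k * (Fk k).wt (.potQ x Y b b') :=
  potQ_entryBound_of_localRate hΛ hNE3.pointwise hread k hg U x Y b b'

/-- [folklore] **THE `NE3Shape` FACE, `potR`.** -/
theorem potR_entryBound_of_ne3Shape {R : Readings ιR XR} {Fk : ℕ → Format (Species T κ ι Ω 𝒴)}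
    {rawA rawB : (ℕ → ℝ) → Bg → ℕ → RawSpecies T κ ι Ω 𝒴} {W : Set (ℕ → ℝ)} {Λ C θ : ℝ} (hΛ : 0 ≤ Λ)
    (hNE3 : NE3Shape R C θ) (hread : PotRLipschitzReading R Fk rawA rawB W Λ) (k : ℕ) {g : ℕ → ℝ} (hg : g ∈ W) (U : Bg) (x : Ω)
    (Y : 𝒴) : ‖(rawA g U k).potR x Y - (rawB g U k).potR x Y‖ ≤ Λ * C * θ ^ k * (Fk k).wt (.potR x Y) :=
  potR_entryBound_of_localRate hΛ hNE3.pointwise hread k hg U x Y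

/-! ## §3 Assembling conjuncts read at different rates -/

/-- [folklore] per-entry monotonicity in (constant, rate): a bound `c·θ^k·w` with `0 ≤ c ≤ c′`, `0 ≤ θ ≤ Θ`, `0 ≤ w` is a bound `c′·Θ^k·w` — so species
conjuncts read at different rates assemble into ONE `SpeciesEntryBound … (c′·Θ^k)` at the slowest rate. -/
theorem entryBound_mono {a c c' θ Θ w : ℝ} {k : ℕ} (h : a ≤ c * θ ^ k * w) (hc : c ≤ c') (hc0 : 0 ≤ c) (hθ0 : 0 ≤ θ) (hθ : θ ≤ Θ)
    (hw : 0 ≤ w) : a ≤ c' * Θ ^ k * w := by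
  refine h.trans (mul_le_mul_of_nonneg_right ?_ hw)
  exact mul_le_mul hc (pow_le_pow_left₀ hθ0 hθ k) (pow_nonneg hθ0 k) (hc0.trans hc)

/-- [folklore] **ASSEMBLY**: five species conjuncts, each with its own constant and rate `(c_s, θ_s)`, `0 ≤ c_s ≤ c`, `0 ≤ θ_s ≤ Θ`, give ONE
`SpeciesEntryBound (Fk k) (rawA g U k) (rawB g U k) (c·Θ^k)` — what `B13Readings.weightedEntrywiseRate_of_entryBound` consumes for the END of record's `hwer`. -/
theorem speciesEntryBound_of_rates {Fk : ℕ → Format (Species T κ ι Ω 𝒴)} {rA rB : RawSpecies T κ ι Ω 𝒴} {k : ℕ}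
    {c₁ c₂ c₃ c₄ c₅ θ₁ θ₂ θ₃ θ₄ θ₅ c Θ : ℝ}
    (h₁ : ∀ t a' a'', ‖rA.cov t a' a'' - rB.cov t a' a''‖ ≤ c₁ * θ₁ ^ k * (Fk k).wt (.cov t a' a''))
    (h₂ : ∀ t i j, ‖rA.deltaKer t i j - rB.deltaKer t i j‖ ≤ c₂ * θ₂ ^ k * (Fk k).wt (.deltaKer t i j))
    (h₃ : ∀ t a' i, ‖rA.gammaConstituent t a' i - rB.gammaConstituent t a' i‖ ≤ c₃ * θ₃ ^ k * (Fk k).wt (.gammaConstituent t a' i))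
    (h₄ : ∀ x Y b b', ‖rA.potQ x Y b b' - rB.potQ x Y b b'‖ ≤ c₄ * θ₄ ^ k * (Fk k).wt (.potQ x Y b b'))
    (h₅ : ∀ x Y, ‖rA.potR x Y - rB.potR x Y‖ ≤ c₅ * θ₅ ^ k * (Fk k).wt (.potR x Y))
    (hc₁ : 0 ≤ c₁) (hc₂ : 0 ≤ c₂) (hc₃ : 0 ≤ c₃) (hc₄ : 0 ≤ c₄) (hc₅ : 0 ≤ c₅)
    (hc₁c : c₁ ≤ c) (hc₂c : c₂ ≤ c) (hc₃c : c₃ ≤ c) (hc₄c : c₄ ≤ c) (hc₅c : c₅ ≤ c)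
    (hθ₁ : 0 ≤ θ₁) (hθ₂ : 0 ≤ θ₂) (hθ₃ : 0 ≤ θ₃) (hθ₄ : 0 ≤ θ₄) (hθ₅ : 0 ≤ θ₅)
    (hθ₁Θ : θ₁ ≤ Θ) (hθ₂Θ : θ₂ ≤ Θ) (hθ₃Θ : θ₃ ≤ Θ) (hθ₄Θ : θ₄ ≤ Θ) (hθ₅Θ : θ₅ ≤ Θ) :
    SpeciesEntryBound (Fk k) rA rB (c * Θ ^ k) where
  cov t a' a'' := entryBound_mono (h₁ t a' a'') hc₁c hc₁ hθ₁ hθ₁Θ ((Fk k).wt_pos _).le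
  deltaKer t i j := entryBound_mono (h₂ t i j) hc₂c hc₂ hθ₂ hθ₂Θ ((Fk k).wt_pos _).le
  gammaConstituent t a' i := entryBound_mono (h₃ t a' i) hc₃c hc₃ hθ₃ hθ₃Θ ((Fk k).wt_pos _).le
  potQ x Y b b' := entryBound_mono (h₄ x Y b b') hc₄c hc₄ hθ₄ hθ₄Θ ((Fk k).wt_pos _).le
  potR x Y := entryBound_mono (h₅ x Y) hc₅c hc₅ hθ₅ hθ₅Θ ((Fk k).wt_pos _).le

end Summit.QuantumFields.BalabanUV.T4Continuum.B13ReadingsLocal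

end
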